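import Summits.BirchSwinnertonDyer.BirchSwinnertonDyer.Theorems.KatoDescentTamePotSupersingularTameUpperLayerZeroDoor
import Summits.BirchSwinnertonDyer.BirchSwinnertonDyer.Theorems.KatoDescentTamePotSupersingularTameUpperUnitTwistRecordsFlat63
import HarnessLib

/-!
# Route `KatoDescentTamePotSupersingular` (rung K8, sub-rung B4 (t′), cell `bsd-potss`): U₀ RECORDS at `p = 5` FROM THE LAYER-0 ISOTYPIC INPUT (c2*)₀
# part 03: the `5Nn` rows decided at DEGREE 48 (kit j334287): 313600ce1

Seat `bsd-potss-k8t-c4` g26; `--supports stmt-BirchSwinnertonDyer-19982 --as helper`. THEOREMS ONLY (no definition, no named fact, no `sorry`);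
nothing booked; (A), Conjecture A and BSD are proved for NO curve here; items 19202 / 19982 stay OPEN at class level (open inputs class-wide: zeta
crux 24439, lower half of 19984).

313600ce1 @ 5 has `5 ∣ h(ℚ(P))` (μ-road UNCOVERABLE) and `rank_5 Cl(ℚ(P)) = 1 > rank_5 Cl(ℚ(x(P))) = 0` (rank-equality road shut, kit j333672);
the degree-24 eigenvalue test (kit j334241: `P ↦ 2P` acts on `Cl(ℚ(P))[5]` by `+2`) left «`E[5]`- or `E^d[5]`-isotypic» open.  DEGREE-48 RESOLUTION
(kit j334287, PARI 2.17, `Cl(ℚ(E[5]))` under GRH: `h = 3600`, `cyc = [60, 60]`, `5`-rank `2`): an order-`24` element `g ∈ Gal(ℚ(E[5])/ℚ)` acts on `E[5]`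
with characteristic polynomial `T² + T + 2` (from `g²P = 3P + 4·gP`) and on `Cl(ℚ(E[5]))[5] ≅ 𝔽₅²` by the matrix `(1 1; 3 0)` with characteristic
polynomial `T² + 4T + 2` — the one of the TWIST `E^d[5] = E[5] ⊗ χ_d` (`ℚ(√d)` = the quadratic subfield of `ℚ(P)`), NOT of `E[5]`.  So the `5`-part of
`Cl(ℚ(E[5]))` is `E^d[5]`-isotypic and (c2*)₀ «`Hom_{Γ_ℚ}(Cl(𝓞_{ℚ(E[5])}), E[5]) = 0`» holds numerically (GRH).  Per row: `MissingUpperBoundAt E 5` from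
`hKatoA hGZK hmod`, Cremona's `r_an = 0`, the basis data and the DISPLAYED input `h0` = (c2*)₀, through
`TameRankEqRecords.missingUpperBoundAt_five_tame_of_nonsplitCartanBasis_of_homTrivial_layerZero` (k8t-c4 g26).  (The same job returned ISO:E5 for
119025ck1 — its `5`-class IS `E[5]`-isotypic, door L6 inapplicable there — and timed out at 17000 s of `bnfinit` on 176400fa1, 243675bt1, 313600cd1,
435600iz1, 476100bv1, 396900eb1, 396900ed1.)  CONDITIONAL; per row; nothing booked; BSD for no curve.

References: [Kato2004Asterisque] Thm. 14.5 (3); [CoatesSujatha2005] Thm. 3.4; [DeoRaySujatha2023] Thm. 3.8; [Washington1997] §13; [Cremona2006] Table 1.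
-/

set_option autoImplicit false
-- the Theorems directory repeats the summit name (`Summits/BirchSwinnertonDyer/BirchSwinnertonDyer/…`): house rule of the cell
set_option linter.dupNamespace false

noncomputable section

open scoped Classical NumberField Matrix
open WeierstrassCurve Field IntermediateField
  Literature.NumberTheory.EllipticCurves Literature.NumberTheory.EllipticCurves.Rank1Residual
  Literature.NumberTheory.EllipticCurves.Rank1Residual.Typed
  Literature.NumberTheory.GaloisRepresentations Literature.NumberTheory.SerreUniformity
  Literature.NumberTheory.IwasawaTheory Literature.NumberTheory.NumberFields
  Summit.BirchSwinnertonDyer.Rank1Residual Summit.BirchSwinnertonDyer.Rank1Residual.Additive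
  Summit.BirchSwinnertonDyer.BirchSwinnertonDyer.Theorems

namespace Summit.BirchSwinnertonDyer.BirchSwinnertonDyer.Theorems.TameRankEqRecords

/-! ### `313600ce1` @ `p = 5` — `N = 313600 = 2^8·5^2·7^2`; Cremona: `r_an = 0`; (t′) at `5`; mod-`5` image `5Nn` (displayed); the rank-equality road is shut
(kit j333672) and the eigenvalue test at degree 24 was ambiguous (`E[5]` or `E^d[5]`, kit j334241).  DEGREE-48 resolution (kit j334287, GRH): `Cl(ℚ(E[5]))`:
`h 3600 cyc [60, 60] r5 2 1335s`; an order-24 Galois element `g` acts on `E[5]` with `g^2P = 3 P + 4 gP tr 4 det 2` and on `Cl(ℚ(E[5]))[5]` by `M_g on Cl[5] = [1, 1; 3, 0] charpoly T^2 + 4*T + 2 rho charpoly T^2 + T + 2 divides: E 0 E^d 1`; verdict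
`ISO:TWIST — the class is E^d[5]-isotypic: (c2*)_0 HOLDS for E` — the `5`-class is NOT `E[5]`-isotypic, so (c2*)₀ holds numerically. -/

/-- **CONDITIONAL U₀ for `313600ce1` @ 5 FROM THE LAYER-0 ISOTYPIC INPUT** — `ord₅ #Ш(E) ≤ ord₅ #Ш_an(E)` (`MissingUpperBoundAt E 5`) for
`E = 313600ce1 = [0, 0, 0, -68600, 6914880]` (`N = 2^8·5^2·7^2`), from: the named facts `hKatoA hGZK hmod`; Cremona's `r_an = 0` (`hr`); the `C_ns⁺(ε)` basis data
(`e hε he σx hσx`, displayed); the layer-0 isotypic input `h0` (displayed; numerically by the degree-48 Galois action, kit j334287, GRH).  NO `μ`-hypothesis,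
NO inertia / decomposition hypothesis.  KERNEL: `E[5]` irreducible, `Addv`, `SubTprime` (tree: `TameUpperUnitTwistRecords.irr_g313600ce1_5`, `addv_g313600ce1_5`, `subTprime_g313600ce1_5`).
Per row; CONDITIONAL; nothing booked; BSD is not proved by this. [cite: Kato2004Asterisque, Thm. 14.5 (3) (p. 236)] [cite: CoatesSujatha2005, §3 Thm. 3.4]
[cite: DeoRaySujatha2023, §3 Thm. 3.8 (arXiv:2202.09937 p. 9)] [cite: Cremona2006, Table 1 (Cremona label 313600ce1)] -/
theorem missingUpperBoundAt_g313600ce1_5_of_homTrivial_layerZero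
    (hKatoA : Kato2004.rankZero_padicValNat_sha_add_padicValNat_tamagawa_le_of_additive_potGood_of_irreducible_of_fineSelmerDual_fg)
    (hGZK : rank_eq_analyticRank_of_analyticRank_le_one) (hmod : hasEntireLFunction_rat)
    {W : WeierstrassCurve ℚ} [W.IsElliptic] [W.IsGloballyMinimal] (hWeq : W = (⟨0, 0, 0, (-68600), 6914880⟩ : WeierstrassCurve ℚ))
    (hr : W.analyticRank = 0)
    (e : W.geomTorsion (5 : ℕ) ≃+ (Fin 2 → ZMod 5)) {ε : ZMod 5} (hε : ¬ IsSquare ε)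
    (he : ∀ σ : absoluteGaloisGroup ℚ, ∃ M ∈ nonsplitCartanNormalizer ε, ∀ P : W.geomTorsion (5 : ℕ), e (σ • P) = M *ᵥ e P)
    (σx : absoluteGaloisGroup ℚ) (hσx : ∀ P : W.geomTorsion (5 : ℕ), e (σx • P) = !![1, ε * (4 - ε); 4 - ε, 1] *ᵥ e P)
    (h0 : ∀ μ : Additive (ClassGroup (𝓞 ↥(W.divisionField 5))) →+ W.geomTorsion (5 : ℕ),
      (∀ (τ : absoluteGaloisGroup ℚ) (c : ClassGroup (𝓞 ↥(W.divisionField 5))),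
        μ (Additive.ofMul (ClassGroup.mulEquiv
          (AmbiguousClass.intAut (absRestrictNormalHom (W.divisionField 5) τ)) c)) = τ • μ (Additive.ofMul c)) → μ = 0) :
    MissingUpperBoundAt W 5 := by
  subst hWeq
  exact missingUpperBoundAt_five_tame_of_nonsplitCartanBasis_of_homTrivial_layerZero _ hKatoA hGZK hmod hr
    TameUpperUnitTwistRecords.addv_g313600ce1_5 TameUpperUnitTwistRecords.subTprime_g313600ce1_5 TameUpperUnitTwistRecords.irr_g313600ce1_5
    e hε he σx hσx h0

end Summit.BirchSwinnertonDyer.BirchSwinnertonDyer.Theorems.TameRankEqRecords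

end
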